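import Mathlib

/-!
# Tier 3, T3.2 — R-B (FINDING 2, §A15 (i)): the infinity type `κ(1−c)` is admissible modulo `p^N`
(seat t3-p3, gen 4; blind re-derivation cell `pub-hodge-repro`; paper: proofs/t3-p3/R2-PINNING-ADDENDUM-3.md §A16)

FINDING 2 (R2-PINNING-ADDENDUM-2.md §A15) twists a corner character `χ_j′` of infinity type `Σ + κ_j(1−c)` by an
anticyclotomic Hecke character `ψ′` of infinity type `κ_j(1−c)` and `p`-power conductor.  Weil's criterion for the
existence of an algebraic Hecke character with a given infinity type `T` and conductor dividing a modulus `𝔪` is that the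
unit character `u ↦ u^T` be trivial on the units `≡ 1 (mod 𝔪)`.  For `T = κ(1−c)` on a CM field `K` this character is
`u ↦ ∏_σ (σ(u)/σ(ū))^{κ_σ}`, a function of `u/ū`, and the criterion is elementary: this file types it.

* `mul_unitsComplexConj_inv_mem_torsion` — Kronecker: `u/ū` is a root of unity for every unit `u` (Mathlib's
  `unitsMulComplexConjInv`, `mem_torsion`);
* `exists_pow_notMem_of_finite` — Krull's intersection theorem: finitely many nonzero elements of a Noetherian domain
  all escape `I^N` for `N` large;
* `map_mem_pow_of_map_mem` — an endomorphism preserving `I` preserves every `I^n`;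
* `exists_pow_forall_unitsComplexConj_eq_self` — THE CORE: for a conjugation-stable proper ideal `I` of `𝓞 K` (e.g.
  `I = p 𝓞 K`) there is `N` such that every unit `u ≡ 1 (mod I^N)` is real, `ū = u`;
* `prod_div_complexConj_zpow_eq_one`, `exists_pow_forall_prod_div_complexConj_zpow_eq_one` — hence the unit character of
  ANY infinity type of the shape `κ(1−c)` (any finite set of embeddings, any integer exponents) is trivial on the units
  `≡ 1 (mod I^N)`: Weil's admissibility condition for `ψ′`, at the level `p^N`.

HONESTY.  Weil's existence theorem itself (the idelic construction of the Hecke character from an admissible type) is NOT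
proved here — it is the cell's print locator (Weil 1955; the cell's own instance is Hsieh's `ν_κ`/`χ_κ`, Main_Body.tex
L481–483).  Nothing here says anything about the status of the Hodge conjecture for CM abelian varieties, which is NOT
proved.
-/

set_option autoImplicit false

namespace Summit.Ventures.HodgeRepro.T3.AdmissibleType

open NumberField NumberField.IsCMField NumberField.Units

section Krull

variable {R : Type*} [CommRing R]

/-- An endomorphism of the ring that maps `I` into `I` maps every power `I ^ n` into `I ^ n`. -/
theorem map_mem_pow_of_map_mem (f : R →+* R) (I : Ideal R) (hf : ∀ x ∈ I, f x ∈ I) (n : ℕ) {x : R}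
    (hx : x ∈ I ^ n) : f x ∈ I ^ n := by
  have hle : Ideal.map f (I ^ n) ≤ I ^ n := by
    rw [Ideal.map_pow]
    refine Ideal.pow_right_mono ?_ n
    rw [Ideal.map_le_iff_le_comap]
    intro y hy
    exact hf y hy
  exact hle (Ideal.mem_map_of_mem f hx)

/-- **Krull's intersection theorem**, finite form: in a Noetherian domain, finitely many nonzero elements all escape
`I ^ N` for some `N` (`I ≠ ⊤`). -/
theorem exists_pow_notMem_of_finite [IsNoetherianRing R] [IsDomain R] (I : Ideal R) (hI : I ≠ ⊤)
    (S : Set R) (hS : S.Finite) (h0 : (0 : R) ∉ S) : ∃ N : ℕ, ∀ x ∈ S, x ∉ I ^ N := by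
  have hbot : ⨅ i : ℕ, I ^ i = ⊥ := Ideal.iInf_pow_eq_bot_of_isDomain I hI
  have hesc : ∀ x ∈ S, ∃ n : ℕ, x ∉ I ^ n := by
    intro x hx
    by_contra hcon
    have hall : ∀ n : ℕ, x ∈ I ^ n := fun n => by
      by_contra hn
      exact hcon ⟨n, hn⟩
    have hmem : x ∈ ⨅ i : ℕ, I ^ i := Ideal.mem_iInf.mpr hall
    rw [hbot, Ideal.mem_bot] at hmem
    exact h0 (hmem ▸ hx)
  choose n hn using hesc
  refine ⟨hS.toFinset.attach.sup (fun x => n x.1 (hS.mem_toFinset.mp x.2)), ?_⟩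
  intro x hx hxN
  have hle : n x hx ≤ hS.toFinset.attach.sup (fun x => n x.1 (hS.mem_toFinset.mp x.2)) :=
    Finset.le_sup (f := fun x => n x.1 (hS.mem_toFinset.mp x.2))
      (Finset.mem_attach _ ⟨x, hS.mem_toFinset.mpr hx⟩)
  exact hn x hx (Ideal.pow_le_pow_right hle hxN)

end Krull

section CMField

variable (K : Type*) [Field K] [CharZero K] [IsCMField K] [NumberField K]

/-- **Kronecker.** For every unit `u` of a CM field, `u / ū` is a root of unity (Mathlib's `unitsMulComplexConjInv`). -/
theorem mul_unitsComplexConj_inv_mem_torsion (u : (𝓞 K)ˣ) :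
    u * (unitsComplexConj K u)⁻¹ ∈ torsion K :=
  (unitsMulComplexConjInv K u).prop

/-- The complex conjugation on `𝓞 K`, read on a unit. -/
theorem coe_unitsComplexConj (u : (𝓞 K)ˣ) :
    ((unitsComplexConj K u : (𝓞 K)ˣ) : 𝓞 K) = ringOfIntegersComplexConj K (u : 𝓞 K) := by
  apply RingOfIntegers.ext
  rfl

/-- **The admissibility core.** Let `I ≠ ⊤` be an ideal of `𝓞 K` stable under complex conjugation (for instance
`I = p 𝓞 K`).  Then there is `N` such that every unit `u ≡ 1 (mod I ^ N)` is fixed by complex conjugation.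
(The roots of unity `ζ ≠ 1` are finitely many and `ζ − 1 ≠ 0` escapes `I ^ N` by Krull; `u/ū` is a root of unity
by Kronecker and `u/ū − 1 = ((u − 1) − (ū − 1))/ū ∈ I ^ N`.) -/
theorem exists_pow_forall_unitsComplexConj_eq_self (I : Ideal (𝓞 K)) (hI : I ≠ ⊤)
    (hc : ∀ x ∈ I, ringOfIntegersComplexConj K x ∈ I) :
    ∃ N : ℕ, ∀ u : (𝓞 K)ˣ, ((u : (𝓞 K)ˣ) : 𝓞 K) - 1 ∈ I ^ N → unitsComplexConj K u = u := by
  -- the finite set of `ζ - 1`, `ζ` a nontrivial root of unity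
  set S : Set (𝓞 K) := (fun ζ : torsion K => ((ζ : (𝓞 K)ˣ) : 𝓞 K) - 1) '' {ζ : torsion K | ζ ≠ 1} with hSdef
  have hSfin : S.Finite := (Set.toFinite _).image _
  have h0 : (0 : 𝓞 K) ∉ S := by
    rintro ⟨ζ, hζ, hζ0⟩
    apply hζ
    have h1 : ((ζ : (𝓞 K)ˣ) : 𝓞 K) = 1 := by
      have := sub_eq_zero.mp hζ0
      exact this
    ext
    exact congrArg (fun x : 𝓞 K => (x : K)) h1
  obtain ⟨N, hN⟩ := exists_pow_notMem_of_finite I hI S hSfin h0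
  refine ⟨N, fun u hu => ?_⟩
  -- `ζ := u / ū`
  set ζ : torsion K := unitsMulComplexConjInv K u with hζdef
  have hζval : ((ζ : (𝓞 K)ˣ) : 𝓞 K) = (u : 𝓞 K) * ((unitsComplexConj K u)⁻¹ : (𝓞 K)ˣ) := by
    rw [hζdef, unitsMulComplexConjInv_apply, Units.val_mul]
  -- `ū - 1 ∈ I ^ N`
  have hconj : ((unitsComplexConj K u : (𝓞 K)ˣ) : 𝓞 K) - 1 ∈ I ^ N := by
    have := map_mem_pow_of_map_mem (ringOfIntegersComplexConj K : (𝓞 K) →+* (𝓞 K)) I hc N hu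
    rw [map_sub, map_one] at this
    rw [coe_unitsComplexConj]
    exact this
  -- `ζ - 1 = ((u - 1) - (ū - 1)) * ū⁻¹ ∈ I ^ N`
  have hζmem : ((ζ : (𝓞 K)ˣ) : 𝓞 K) - 1 ∈ I ^ N := by
    have hsub : ((u : (𝓞 K)ˣ) : 𝓞 K) - ((unitsComplexConj K u : (𝓞 K)ˣ) : 𝓞 K) ∈ I ^ N := by
      have := Ideal.sub_mem _ hu hconj
      simpa using this
    have heq : ((ζ : (𝓞 K)ˣ) : 𝓞 K) - 1 =
        (((u : (𝓞 K)ˣ) : 𝓞 K) - ((unitsComplexConj K u : (𝓞 K)ˣ) : 𝓞 K)) *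
          ((unitsComplexConj K u)⁻¹ : (𝓞 K)ˣ) := by
      rw [hζval, sub_mul, Units.mul_inv]
    rw [heq]
    exact Ideal.mul_mem_right _ _ hsub
  -- hence `ζ = 1`
  have hζ1 : ζ = 1 := by
    by_contra hne
    exact hN _ ⟨ζ, hne, rfl⟩ hζmem
  -- and so `ū = u`
  have h1 : u * (unitsComplexConj K u)⁻¹ = 1 := by
    have h := congrArg (fun ζ : torsion K => (ζ : (𝓞 K)ˣ)) hζ1
    rw [hζdef, unitsMulComplexConjInv_apply, OneMemClass.coe_one] at h
    exact h
  exact (mul_inv_eq_one.mp h1).symm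

/-- The unit character of an infinity type of the shape `κ(1−c)` — `u ↦ ∏_{σ ∈ S} (σ(u)/σ(ū))^{κ_σ}` for ANY finite
set `S` of complex embeddings and ANY integer exponents `κ` — is trivial on the real units. -/
theorem prod_div_complexConj_zpow_eq_one (S : Finset (K →+* ℂ)) (κ : (K →+* ℂ) → ℤ) (u : (𝓞 K)ˣ)
    (hu : unitsComplexConj K u = u) :
    ∏ φ ∈ S, (φ (u : K) / φ (complexConj K (u : K))) ^ κ φ = 1 := by
  have hfix : complexConj K (u : K) = (u : K) := by
    have := congrArg (fun v : (𝓞 K)ˣ => ((v : (𝓞 K)ˣ) : K)) hu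
    exact this
  refine Finset.prod_eq_one fun φ _ => ?_
  rw [hfix, div_self, one_zpow]
  exact (map_ne_zero φ).mpr (coe_ne_zero u)

/-- **Weil's admissibility condition for `κ(1−c)`.** For a conjugation-stable proper ideal `I` of `𝓞 K` there is `N`
such that the unit character of every infinity type of the shape `κ(1−c)` is trivial on the units `≡ 1 (mod I ^ N)`. -/
theorem exists_pow_forall_prod_div_complexConj_zpow_eq_one (I : Ideal (𝓞 K)) (hI : I ≠ ⊤)
    (hc : ∀ x ∈ I, ringOfIntegersComplexConj K x ∈ I) :
    ∃ N : ℕ, ∀ (S : Finset (K →+* ℂ)) (κ : (K →+* ℂ) → ℤ) (u : (𝓞 K)ˣ),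
      ((u : (𝓞 K)ˣ) : 𝓞 K) - 1 ∈ I ^ N →
        ∏ φ ∈ S, (φ (u : K) / φ (complexConj K (u : K))) ^ κ φ = 1 := by
  obtain ⟨N, hN⟩ := exists_pow_forall_unitsComplexConj_eq_self K I hI hc
  exact ⟨N, fun S κ u hu => prod_div_complexConj_zpow_eq_one K S κ u (hN u hu)⟩

/-- The ideal `p 𝓞 K` is stable under complex conjugation (so the theorems above apply to `I = p 𝓞 K`). -/
theorem map_mem_span_singleton_natCast (p : ℕ) {x : 𝓞 K}
    (hx : x ∈ Ideal.span {((p : ℕ) : 𝓞 K)}) :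
    ringOfIntegersComplexConj K x ∈ Ideal.span {((p : ℕ) : 𝓞 K)} := by
  rw [Ideal.mem_span_singleton] at hx ⊢
  obtain ⟨y, rfl⟩ := hx
  exact ⟨ringOfIntegersComplexConj K y, by rw [map_mul, map_natCast]⟩

end CMField

end Summit.Ventures.HodgeRepro.T3.AdmissibleType
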